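import Summits.HodgeConjecture.HodgeConjecture.Theorems.SixfoldTableXCensusWeilGeneralRow
import Literature.AlgebraicGeometry.HodgeTheory.WeilTypeHodgeRingOfCentralizerDetOne
import HarnessLib

/-!
# TABLE X (dimension 6) — rows 11 `g6.IV(2,1).kE0` and 13 `g6.IV(3,1).kE0`, the GENERAL members of the type-IV
# Weil carriers with `End⁰ = E ⊋ K` (`Hg = U_E ∩ SU_K`): the census nodes X2 / X1 IN THE KERNEL under the displayed
# group hypothesis «`Hg(A) ⊇ S(A)(ℂ) ∩ SU_K`», with domain membership; and HC for these sixfolds from {Markman₆, R-W6}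
# (cell `pub-hodgeav-hg6`, req-37 (A) Q2b; eng-4 g6, the «⟨D, W_K⟩ socket» of INVENTORY-g5-ADDENDUM §3 (2))

HONEST FRAMING. HC, `HC_AV` (stmt-1333), `HC_CM` (stmt-3052) and the rung H2 are NOT proved and do not occur here. The
census nodes X2 / X1 (`TableX.SixfoldCodimTwoCensus` / `TableX.SixfoldCodimThreeCensus` of `SixfoldTableXCover`) are OURS
(`@[conjecture]`), never asserted; the residue R-W6 (`WeilTypeLadder.NonsplitSixfolds`) and Markman's hyperbolic-sixfold
theorem (`Markman2025_weilClasses_algebraic_hyperbolicSixfold`, preprint, UNREFEREED) appear ONLY as displayed hypotheses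
of §3. The group hypothesis «every `u ∈ S(A)(ℂ)` with `det(u | W) = 1` lies in `Hg(A)(ℂ)|_{H¹}`» — the GENERAL MEMBER of
the family (`Hg = U_E ∩ SU_K`; Moonen–Zarhin) — is DISPLAYED on every theorem and never discharged; SPECIAL members
(`Hg ⊊ U_E ∩ SU_K`) are NOT covered. KERNEL ONLY: theorems over existing declarations; no definition, no `sorry`, no named
fact used as an axiom; the algebraicity of Weil classes is NOT touched; typed ≠ proved.

WHY THIS MODULE (census-node self-audit, axis A7 «a row VERIFIED in the kernel, not by dossier», continued from L12
`SixfoldTableXCensusWeilGeneralRow` — row 9, `End⁰ = K`, van Geemen's `Hg = SU_H`). Rows 11 and 13 of TABLE X are the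
simple sixfolds of Albert type IV with `End⁰(A) = E` a CM field of degree `4` resp. `6` containing an imaginary quadratic
`K = ℚ(φ)`, `φ² = -d`, acting with multiplicities `(3,3)`; there `Hg ⊆ U_E ∩ SU_K ⊊ SU_K`, so L12 does not apply
(`HasHodgeGroupSU` forces `End⁰ = K`), and the unitary sockets of eng-4 g5 (hypothesis `hU`: `Hg ⊇ U_E` in Lie form) fail
by design. The cell's engines (J1, ×2: eng-5 flint / eng-1 GAP) found `B• = D• ⊕ W_K`, `exc = (0,0,2,0,0)`, for the
general member. The Literature theorem `isDivisorWeilGenerated_of_hodgeGroup_ge_unitaryCentralizer_detOne`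
(`HodgeTheory/WeilTypeHodgeRingOfCentralizerDetOne`, this seat) proves exactly this in the kernel: Milne's Lefschetz theorem
for one generator with a Rosati partner (`Milne1999.mem_divisorClassesSpan_of_forall_exteriorPullback_eq_of_adjoint`:
the `S(A)(ℂ)`-invariants are divisorial) + the `K`-torus weight splitting (the extra invariants of the determinant-one
subgroup are the two tops `⋀⁶W`, `⋀⁶W̄` = the Weil plane). This file feeds it into the census nodes:
* §1 `WeilERows.weilClassesOf_le_weilSummand_of_isWeilType` — `W_K(A) ⊗ ℂ ≤` X1's sixfold-Weil summand at `A`, for ANY pair of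
  Weil type `(3, d)` (van Geemen 4.9 / 4.10: the plane is spanned by rational `(3,3)` classes; `B′ = A`, `g = 𝟙`).
* §2 **`WeilERows.census_weilType_generalE`** — for `(A, φ)` of Weil type `(3, d)`, `A` simple and not of CM type (the domain
  `dim A = 6 ∧ ¬ 𝒞 A`), Milne's single-generator data for `C(A) ⊗ ℂ` at a rational class `h` with a Kähler multiple
  (`End⁰(A) = E = ℚ(φ_E)`, `φ_E^*` diagonalisable with `Q_h`-adjoint `J'`), `φ^*` a `d`-similitude of `Q_h`, and the DISPLAYED
  group hypothesis: `(dim A = 6 ∧ ¬ 𝒞 A) ∧` X2-at-`A` `∧` X1-at-`A`; `…_of_isIsogenous` — on the whole isogeny class (L7 / L7b).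
  ONE statement serves rows 11 AND 13 (and re-proves row 9's general member from Milne): the degree of `E` does not enter.
* §3 **`WeilERows.hodgeConjectureFor_weilType_generalE_of_markman₆_nonsplit`** — HC for these sixfolds from the NAMED RESIDUES
  {Markman₆, R-W6} ALONE (`hodgeConjectureFor_of_isDivisorWeilGenerated` + Lefschetz (1,1) + the ladder item
  `WeilSixfolds`); Markman₄, `HC_CM` and the census nodes drop out, as on row 9. (Row 11: every member is split — TABLE X v1 §1,
  J5 — so there R-W6 is met vacuously and Markman₆ alone pays; that arithmetic is NOT formalised here.)
WHAT IS NOT COVERED (honest scope): the SPECIAL members of rows 9 / 11 / 13; row 7 (type III); the product Weil rows; the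
positivity facts «Rosati = conjugation on `E`» and «`Hg` of the general member IS `U_E ∩ SU_K`» (displayed, not proved).

All declarations in the sub-namespace `TableX.WeilERows`. Nothing here is a corollary of `HC_CM`; no hypothesis of the cover
is discharged GLOBALLY (X2 / X1 quantify over ALL off-residue sixfolds and stay `@[conjecture]`); typed ≠ proved.
-/

set_option linter.dupNamespace false

noncomputable section

open CategoryTheory
open Literature.AlgebraicGeometry Literature.AlgebraicGeometry.Motives
open Literature.AlgebraicGeometry.Motives.AbelianVariety (IsIsogenous IsSimple)
open Literature.AlgebraicGeometry.HodgeTheory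
open Literature.AlgebraicGeometry.Milne1999
open Literature.AlgebraicGeometry.VanGeemen1994 (pullbackOne hodgeGroupOne detOnEigenspace)
open Literature.AlgebraicTopology.SingularHomology
open Literature.Barriers.HodgeConjecture
open Summit.HodgeConjecture.HodgeConjecture.Ring2.ClassTargets
open Summit.HodgeConjecture.HodgeConjecture.Ring2.Motiv (ProdCMCell)
open Summit.HodgeConjecture.HodgeConjecture.Ring2.Atlas (IsQuarticFieldTypeIVFourfold)

namespace Summit.HodgeConjecture.HodgeConjecture.TableX.WeilERows

variable (A : AbelianVariety ℂ) (φ : A ⟶ A) (d : ℕ)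

/-! ## §1 The Weil plane of a Weil-type pair sits inside X1's sixfold-Weil summand -/

/-- **`W_K(A) ⊗ ℂ ≤` the sixfold-Weil summand of X1 at `A`** for every pair `(A, φ)` of Weil type `(3, d)`: `W_K ⊗ ℂ` is the
complex span of its RATIONAL members (van Geemen 4.9, `weilClassesOf_eq_span_isRationalClass`), each of which is of Hodge
type `(3,3)` (4.10, `IsWeilType.isOfHodgeType_of_mem_weilClassesOf`) and is its own push-forward along `g = 𝟙 A.X` from
`B′ = A`, `ψ = φ`. [cite: vanGeemen1994HodgeAV, 4.9–4.10] [cite: MoonenZarhin1998WeilClasses, §1 Criterion] -/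
theorem weilClassesOf_le_weilSummand_of_isWeilType (hW : IsWeilType A φ 3 d) :
    weilClassesOf A φ 3 d ≤ Submodule.span ℂ {w' : complexBetti A.X (2 * 3) |
      ∃ (B' : AbelianVariety ℂ) (g : A.X ⟶ B'.X) (d : ℕ) (ψ : B' ⟶ B') (w : complexBetti B'.X (2 * 3)),
        B'.dim = 6 ∧ 0 < d ∧ ψ ≫ ψ = -(d • 𝟙 B') ∧ IsRationalClass w ∧
        IsOfHodgeType B'.dim B'.X (2 * 3) 3 3 w ∧ w ∈ weilClassesOf B' ψ 3 d ∧
        w' = complexBetti.map g (2 * 3) w} := by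
  rw [weilClassesOf_eq_span_isRationalClass (by norm_num) hW.dim_eq hW.d_pos hW.sq_eq]
  refine Submodule.span_mono ?_
  rintro c ⟨hcQ, hcW⟩
  refine ⟨A, 𝟙 A.X, d, φ, c, by rw [hW.dim_eq], hW.d_pos, hW.sq_eq, hcQ, ?_, hcW, ?_⟩
  · rw [hW.dim_eq]; exact hW.isOfHodgeType_of_mem_weilClassesOf hcW
  · rw [complexBetti.map_id]; rfl

/-! ## §2 Rows 11 / 13, general member: domain membership and both census conclusions, in the kernel -/

variable {h : complexBetti A.X 2}

/-- **TABLE X ROWS 11 `g6.IV(2,1).kE0` / 13 `g6.IV(3,1).kE0`, GENERAL MEMBER, KERNEL VERDICT WITH DOMAIN MEMBERSHIP.** For a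
complex abelian sixfold `A` with `(A, φ)` of Weil type `(3, d)` (`φ² = -d`, `K = ℚ(φ)` acting with multiplicities `(3,3)`),
`A` SIMPLE and NOT of CM type, a rational class `h` with a Kähler multiple whose polarization pairing `Q_h` has `φ^*` as a
`d`-similitude, Milne's single-generator data (`C(A) ⊗ ℂ` = commutant of one diagonalisable `φ_E^*` with `Q_h`-adjoint `J'` in
the bicommutant: `End⁰(A) = E = ℚ(φ_E)` a CM field ⊋ K), and the DISPLAYED general-member hypothesis «every
`u ∈ S(A)(ℂ) = unitaryCentralizerGroup A h` with `det(u | W) = 1` lies in `hodgeGroupOne A.dim A.X`» (`Hg ⊇ U_E ∩ SU_K`):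
`dim A = 6 ∧ ¬ 𝒞 A` (L7 `not_residueClass_of_isSimple_of_not_isOfCMType`), AND X2-at-`A` (`B² ⊆ D² ⊗ ℂ`: the divisor summand
alone) AND X1-at-`A` (`B³ ⊆ D³ ⊗ ℂ ⊔ W_K ⊗ ℂ`, §1: the divisor summand and the sixfold-Weil summand) — by
`isDivisorWeilGenerated_of_hodgeGroup_ge_unitaryCentralizer_detOne`. General member only: special members NOT covered;
HC / HC_AV NOT proved. [cite: Milne1999LefschetzClasses, Thm. 3.2 and Cor. 4.5] [cite: vanGeemen1994HodgeAV, Thm. 6.12 and 4.9]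
[cite: MoonenZarhin1999LowDim, (1.9) and (2.3)] [cite: MoonenZarhin1998WeilClasses, §1] -/
theorem census_weilType_generalE (hW : IsWeilType A φ 3 d) (hS : IsSimple A) (hcm : ¬ IsOfCMType A)
    (φE : A ⟶ A) (hC : centralizerAlgebra A = Subalgebra.centralizer ℂ {pullbackOne A φE})
    (hdiag : ⨆ μ : ℂ, Module.End.eigenspace (pullbackOne A φE) μ = ⊤)
    (hQ : IsRationalClass h) (hK : ∃ s : ℝ, 0 < s ∧ IsKaehlerClass A.dim A.X ((s : ℂ) • h))
    (J' : Module.End ℂ (complexBetti A.X 1))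
    (hJ' : J' ∈ Subalgebra.centralizer ℂ (centralizerAlgebra A : Set (Module.End ℂ (complexBetti A.X 1))))
    (hJQ : ∀ x y : complexBetti A.X 1,
      polarizationPairingOne A.X h (A.dim - 1) (pullbackOne A φE x) y =
        polarizationPairingOne A.X h (A.dim - 1) x (J' y))
    (hφQ : ∀ x y, polarizationPairingOne A.X h (A.dim - 1) (pullbackOne A φ x) (pullbackOne A φ y) =
      (d : ℂ) • polarizationPairingOne A.X h (A.dim - 1) x y)
    (hG : ∀ (u : complexBetti A.X 1 ≃ₗ[ℂ] complexBetti A.X 1) (hu : u ∈ unitaryCentralizerGroup A h),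
      detOnEigenspace u (pullbackOne A φ) (fun x ↦ (mem_centralizerGroup_iff.1 hu.1) φ x)
        (Complex.I * (Real.sqrt d : ℂ)) = 1 → u ∈ hodgeGroupOne A.dim A.X) :
    (A.dim = 6 ∧ ¬ (IsOfCMType A ∨ ProdCMCell IsQuarticFieldTypeIVFourfold (fun Z ↦ Z.dim = 2) A)) ∧
    (∀ c : complexBetti A.X (2 * 2), IsRationalClass c → IsOfHodgeType A.dim A.X (2 * 2) 2 2 c →
      c ∈ divisorClassesSpan A.X A.dim 2 ⊔ Submodule.span ℂ {w' : complexBetti A.X (2 * 2) |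
        ∃ (C : AbelianVariety ℂ) (g : A.X ⟶ C.X) (w : complexBetti C.X (2 * 2)), C.dim < A.dim ∧
          IsRationalClass w ∧ IsOfHodgeType C.dim C.X (2 * 2) 2 2 w ∧ w' = complexBetti.map g (2 * 2) w}) ∧
    (∀ c : complexBetti A.X (2 * 3), IsRationalClass c → IsOfHodgeType A.dim A.X (2 * 3) 3 3 c →
      c ∈ divisorClassesSpan A.X A.dim 3 ⊔ Submodule.span ℂ {w' : complexBetti A.X (2 * 3) |
          ∃ (a : complexBetti A.X (2 * 2)) (b : complexBetti A.X (2 * 1)),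
            IsRationalClass a ∧ IsOfHodgeType A.dim A.X (2 * 2) 2 2 a ∧ IsRationalClass b ∧
            IsOfHodgeType A.dim A.X (2 * 1) 1 1 b ∧ w' = cupProduct (two_mul_add_two_mul 2 1) a b} ⊔
        Submodule.span ℂ {w' : complexBetti A.X (2 * 3) |
          ∃ (C : AbelianVariety ℂ) (g : A.X ⟶ C.X) (w : complexBetti C.X (2 * 3)), C.dim < A.dim ∧
            IsRationalClass w ∧ IsOfHodgeType C.dim C.X (2 * 3) 3 3 w ∧ w' = complexBetti.map g (2 * 3) w} ⊔
        Submodule.span ℂ {w' : complexBetti A.X (2 * 3) |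
          ∃ (B' : AbelianVariety ℂ) (g : A.X ⟶ B'.X) (d : ℕ) (ψ : B' ⟶ B') (w : complexBetti B'.X (2 * 3)),
            B'.dim = 6 ∧ 0 < d ∧ ψ ≫ ψ = -(d • 𝟙 B') ∧ IsRationalClass w ∧
            IsOfHodgeType B'.dim B'.X (2 * 3) 3 3 w ∧ w ∈ weilClassesOf B' ψ 3 d ∧
            w' = complexBetti.map g (2 * 3) w}) := by
  obtain ⟨hBD, hB3⟩ := isDivisorWeilGenerated_of_hodgeGroup_ge_unitaryCentralizer_detOne A φ (by norm_num)
    hW.dim_eq hW.d_pos hW.sq_eq φE hC hdiag hQ hK J' hJ' hJQ hφQ hG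
  refine ⟨⟨by rw [hW.dim_eq], not_residueClass_of_isSimple_of_not_isOfCMType hS hcm⟩, fun c hcQ hcH ↦ ?_,
    fun c hcQ hcH ↦ ?_⟩
  · exact Submodule.mem_sup_left (hBD 2 c (by norm_num) hcQ hcH)
  · obtain ⟨x, hx, y, hy, rfl⟩ := Submodule.mem_sup.1 (hB3 c hcQ hcH)
    exact Submodule.add_mem _ (Submodule.mem_sup_left (Submodule.mem_sup_left (Submodule.mem_sup_left hx)))
      (Submodule.mem_sup_right (weilClassesOf_le_weilSummand_of_isWeilType A φ d hW hy))

/-- **Rows 11 / 13, general member, on the whole ISOGENY CLASS**: everything isogenous to such an `A` is in the nodes'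
domain and satisfies both census conclusions (L7 `offResidueSix_iff_of_isIsogenous`, L7b
`codimTwo/ThreeCensusAt_iff_of_isIsogenous`). General member only. [cite: Milne1999LefschetzClasses, Thm. 3.2 and Cor. 4.5]
[cite: vanGeemen1994HodgeAV, Thm. 6.12 and Lemma 3.7] [cite: MoonenZarhin1999LowDim, §5 (5.1)] -/
theorem census_weilType_generalE_of_isIsogenous {A' : AbelianVariety ℂ} (hW : IsWeilType A φ 3 d) (hS : IsSimple A)
    (hcm : ¬ IsOfCMType A)
    (φE : A ⟶ A) (hC : centralizerAlgebra A = Subalgebra.centralizer ℂ {pullbackOne A φE})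
    (hdiag : ⨆ μ : ℂ, Module.End.eigenspace (pullbackOne A φE) μ = ⊤)
    (hQ : IsRationalClass h) (hK : ∃ s : ℝ, 0 < s ∧ IsKaehlerClass A.dim A.X ((s : ℂ) • h))
    (J' : Module.End ℂ (complexBetti A.X 1))
    (hJ' : J' ∈ Subalgebra.centralizer ℂ (centralizerAlgebra A : Set (Module.End ℂ (complexBetti A.X 1))))
    (hJQ : ∀ x y : complexBetti A.X 1,
      polarizationPairingOne A.X h (A.dim - 1) (pullbackOne A φE x) y =
        polarizationPairingOne A.X h (A.dim - 1) x (J' y))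
    (hφQ : ∀ x y, polarizationPairingOne A.X h (A.dim - 1) (pullbackOne A φ x) (pullbackOne A φ y) =
      (d : ℂ) • polarizationPairingOne A.X h (A.dim - 1) x y)
    (hG : ∀ (u : complexBetti A.X 1 ≃ₗ[ℂ] complexBetti A.X 1) (hu : u ∈ unitaryCentralizerGroup A h),
      detOnEigenspace u (pullbackOne A φ) (fun x ↦ (mem_centralizerGroup_iff.1 hu.1) φ x)
        (Complex.I * (Real.sqrt d : ℂ)) = 1 → u ∈ hodgeGroupOne A.dim A.X)
    (hA'A : IsIsogenous A' A) :
    (A'.dim = 6 ∧ ¬ (IsOfCMType A' ∨ ProdCMCell IsQuarticFieldTypeIVFourfold (fun Z ↦ Z.dim = 2) A')) ∧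
    (∀ c : complexBetti A'.X (2 * 2), IsRationalClass c → IsOfHodgeType A'.dim A'.X (2 * 2) 2 2 c →
      c ∈ divisorClassesSpan A'.X A'.dim 2 ⊔ Submodule.span ℂ {w' : complexBetti A'.X (2 * 2) |
        ∃ (C : AbelianVariety ℂ) (g : A'.X ⟶ C.X) (w : complexBetti C.X (2 * 2)), C.dim < A'.dim ∧
          IsRationalClass w ∧ IsOfHodgeType C.dim C.X (2 * 2) 2 2 w ∧ w' = complexBetti.map g (2 * 2) w}) ∧
    (∀ c : complexBetti A'.X (2 * 3), IsRationalClass c → IsOfHodgeType A'.dim A'.X (2 * 3) 3 3 c →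
      c ∈ divisorClassesSpan A'.X A'.dim 3 ⊔ Submodule.span ℂ {w' : complexBetti A'.X (2 * 3) |
          ∃ (a : complexBetti A'.X (2 * 2)) (b : complexBetti A'.X (2 * 1)),
            IsRationalClass a ∧ IsOfHodgeType A'.dim A'.X (2 * 2) 2 2 a ∧ IsRationalClass b ∧
            IsOfHodgeType A'.dim A'.X (2 * 1) 1 1 b ∧ w' = cupProduct (two_mul_add_two_mul 2 1) a b} ⊔
        Submodule.span ℂ {w' : complexBetti A'.X (2 * 3) |
          ∃ (C : AbelianVariety ℂ) (g : A'.X ⟶ C.X) (w : complexBetti C.X (2 * 3)), C.dim < A'.dim ∧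
            IsRationalClass w ∧ IsOfHodgeType C.dim C.X (2 * 3) 3 3 w ∧ w' = complexBetti.map g (2 * 3) w} ⊔
        Submodule.span ℂ {w' : complexBetti A'.X (2 * 3) |
          ∃ (B' : AbelianVariety ℂ) (g : A'.X ⟶ B'.X) (d : ℕ) (ψ : B' ⟶ B') (w : complexBetti B'.X (2 * 3)),
            B'.dim = 6 ∧ 0 < d ∧ ψ ≫ ψ = -(d • 𝟙 B') ∧ IsRationalClass w ∧
            IsOfHodgeType B'.dim B'.X (2 * 3) 3 3 w ∧ w ∈ weilClassesOf B' ψ 3 d ∧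
            w' = complexBetti.map g (2 * 3) w}) := by
  obtain ⟨hdom, h2, h3⟩ := census_weilType_generalE A φ d hW hS hcm φE hC hdiag hQ hK J' hJ' hJQ hφQ hG
  exact ⟨(offResidueSix_iff_of_isIsogenous hA'A).mpr hdom, (codimTwoCensusAt_iff_of_isIsogenous hA'A).mpr h2,
    (codimThreeCensusAt_iff_of_isIsogenous hA'A).mpr h3⟩

/-! ## §3 HC for the general type-IV Weil sixfold from the named residues alone: the census nodes drop out -/

/-- **HC for the general member of rows 11 / 13 from the ladder item `WeilSixfolds` ALONE** (no census node, no Markman₄, no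
`HC_CM`): under the displayed group hypothesis `B• ⊆ D• + W_K` (`IsDivisorWeilGenerated`), the divisor ring is algebraic by
Lefschetz (1,1) (`lefschetzOneOne_rational_holds`, `AbelianVariety.divisorClassesSpan_le_algebraicClasses`), and `WeilSixfolds`
(`SevenfoldWeilCensus.WeilSixfolds`, stmt-HodgeConjecture-2524, read on `weilClassesOf` by
`WeilTypeLadder.weilSixfolds_iff_weilClassesOf`) makes the rational `(3,3)` Weil classes of `(A, φ)` algebraic; assemble with
`hodgeConjectureFor_of_isDivisorWeilGenerated`. The binder is displayed, not asserted.
[cite: vanGeemen1994HodgeAV, 2.4 and Thm. 6.12] [cite: Milne1999LefschetzClasses, Cor. 4.5] [cite: MoonenZarhin1999LowDim, Thm. 0.2] -/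
theorem hodgeConjectureFor_weilType_generalE_of_weilSixfolds (hW₆ : Theses.SevenfoldWeilCensus.WeilSixfolds)
    (hW : IsWeilType A φ 3 d)
    (φE : A ⟶ A) (hC : centralizerAlgebra A = Subalgebra.centralizer ℂ {pullbackOne A φE})
    (hdiag : ⨆ μ : ℂ, Module.End.eigenspace (pullbackOne A φE) μ = ⊤)
    (hQ : IsRationalClass h) (hK : ∃ s : ℝ, 0 < s ∧ IsKaehlerClass A.dim A.X ((s : ℂ) • h))
    (J' : Module.End ℂ (complexBetti A.X 1))
    (hJ' : J' ∈ Subalgebra.centralizer ℂ (centralizerAlgebra A : Set (Module.End ℂ (complexBetti A.X 1))))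
    (hJQ : ∀ x y : complexBetti A.X 1,
      polarizationPairingOne A.X h (A.dim - 1) (pullbackOne A φE x) y =
        polarizationPairingOne A.X h (A.dim - 1) x (J' y))
    (hφQ : ∀ x y, polarizationPairingOne A.X h (A.dim - 1) (pullbackOne A φ x) (pullbackOne A φ y) =
      (d : ℂ) • polarizationPairingOne A.X h (A.dim - 1) x y)
    (hG : ∀ (u : complexBetti A.X 1 ≃ₗ[ℂ] complexBetti A.X 1) (hu : u ∈ unitaryCentralizerGroup A h),
      detOnEigenspace u (pullbackOne A φ) (fun x ↦ (mem_centralizerGroup_iff.1 hu.1) φ x)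
        (Complex.I * (Real.sqrt d : ℂ)) = 1 → u ∈ hodgeGroupOne A.dim A.X) :
    HodgeConjectureFor A.dim A.X := by
  have hDW := isDivisorWeilGenerated_of_hodgeGroup_ge_unitaryCentralizer_detOne A φ (by norm_num)
    hW.dim_eq hW.d_pos hW.sq_eq φE hC hdiag hQ hK J' hJ' hJQ hφQ hG
  have h11 : ∀ b : complexBetti A.X (2 * 1), IsRationalClass b → IsOfHodgeType A.dim A.X (2 * 1) 1 1 b →
      b ∈ algebraicClasses A.X 1 :=
    fun b hb hb' ↦ lefschetzOneOne_rational_holds (AbelianVariety.isSmoothProjective_holds (A := A)) b hb hb'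
  refine hodgeConjectureFor_of_isDivisorWeilGenerated hW hDW (AbelianVariety.divisorClassesSpan_le_algebraicClasses A h11)
    fun c hcW hcQ hcH ↦ ?_
  exact WeilTypeLadder.weilSixfolds_iff_weilClassesOf.mp hW₆ d hW.d_pos A φ hW.dim_eq hW.isSmoothProjective hW.sq_eq c
    hcQ hcH hcW

/-- **HC for the general member of rows 11 / 13 from the NAMED RESIDUES {Markman₆, R-W6} ALONE.** GRANTED Markman's
hyperbolic-sixfold theorem (`Markman2025_weilClasses_algebraic_hyperbolicSixfold`, arXiv:2502.03415 Thm. 1.5.1, preprint,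
UNREFEREED; the split / discriminant-`−1` range) and the residue R-W6 = `WeilTypeLadder.NonsplitSixfolds` (OPEN), every
sixfold's rational `(3,3)` Weil classes are algebraic (`WeilTypeLadder.weilSixfolds_of_nonsplitSixfolds_of_floor`), hence HC
holds at every such `A` (previous theorem). Neither displayed hypothesis is asserted; the algebraicity of Weil classes is not
touched; the group hypothesis is the general member only. [cite: Markman2025SecantWeil, Thm. 1.5.1 (preprint, unrefereed)]
[claim: Markman2025SurveySecant, status: under-review] [cite: vanGeemen1994HodgeAV, Thm. 6.12] [cite: Milne1999LefschetzClasses, Cor. 4.5] -/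
theorem hodgeConjectureFor_weilType_generalE_of_markman₆_nonsplit
    (hMark₆ : Markman2025_weilClasses_algebraic_hyperbolicSixfold) (hRW6 : WeilTypeLadder.NonsplitSixfolds)
    (hW : IsWeilType A φ 3 d)
    (φE : A ⟶ A) (hC : centralizerAlgebra A = Subalgebra.centralizer ℂ {pullbackOne A φE})
    (hdiag : ⨆ μ : ℂ, Module.End.eigenspace (pullbackOne A φE) μ = ⊤)
    (hQ : IsRationalClass h) (hK : ∃ s : ℝ, 0 < s ∧ IsKaehlerClass A.dim A.X ((s : ℂ) • h))
    (J' : Module.End ℂ (complexBetti A.X 1))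
    (hJ' : J' ∈ Subalgebra.centralizer ℂ (centralizerAlgebra A : Set (Module.End ℂ (complexBetti A.X 1))))
    (hJQ : ∀ x y : complexBetti A.X 1,
      polarizationPairingOne A.X h (A.dim - 1) (pullbackOne A φE x) y =
        polarizationPairingOne A.X h (A.dim - 1) x (J' y))
    (hφQ : ∀ x y, polarizationPairingOne A.X h (A.dim - 1) (pullbackOne A φ x) (pullbackOne A φ y) =
      (d : ℂ) • polarizationPairingOne A.X h (A.dim - 1) x y)
    (hG : ∀ (u : complexBetti A.X 1 ≃ₗ[ℂ] complexBetti A.X 1) (hu : u ∈ unitaryCentralizerGroup A h),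
      detOnEigenspace u (pullbackOne A φ) (fun x ↦ (mem_centralizerGroup_iff.1 hu.1) φ x)
        (Complex.I * (Real.sqrt d : ℂ)) = 1 → u ∈ hodgeGroupOne A.dim A.X) :
    HodgeConjectureFor A.dim A.X :=
  hodgeConjectureFor_weilType_generalE_of_weilSixfolds A φ d
    (WeilTypeLadder.weilSixfolds_of_nonsplitSixfolds_of_floor hMark₆ hRW6) hW φE hC hdiag hQ hK J' hJ' hJQ hφQ hG

/-- **… and on the whole isogeny class** (van Geemen Lemma 3.7 = `HodgeConjectureFor.of_isIsogenous`).
[cite: vanGeemen1994HodgeAV, Lemma 3.7 and Thm. 6.12] [cite: Markman2025SecantWeil, Thm. 1.5.1 (preprint, unrefereed)] -/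
theorem hodgeConjectureFor_of_isIsogenous_weilType_generalE_of_markman₆_nonsplit {A' : AbelianVariety ℂ}
    (hMark₆ : Markman2025_weilClasses_algebraic_hyperbolicSixfold) (hRW6 : WeilTypeLadder.NonsplitSixfolds)
    (hW : IsWeilType A φ 3 d)
    (φE : A ⟶ A) (hC : centralizerAlgebra A = Subalgebra.centralizer ℂ {pullbackOne A φE})
    (hdiag : ⨆ μ : ℂ, Module.End.eigenspace (pullbackOne A φE) μ = ⊤)
    (hQ : IsRationalClass h) (hK : ∃ s : ℝ, 0 < s ∧ IsKaehlerClass A.dim A.X ((s : ℂ) • h))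
    (J' : Module.End ℂ (complexBetti A.X 1))
    (hJ' : J' ∈ Subalgebra.centralizer ℂ (centralizerAlgebra A : Set (Module.End ℂ (complexBetti A.X 1))))
    (hJQ : ∀ x y : complexBetti A.X 1,
      polarizationPairingOne A.X h (A.dim - 1) (pullbackOne A φE x) y =
        polarizationPairingOne A.X h (A.dim - 1) x (J' y))
    (hφQ : ∀ x y, polarizationPairingOne A.X h (A.dim - 1) (pullbackOne A φ x) (pullbackOne A φ y) =
      (d : ℂ) • polarizationPairingOne A.X h (A.dim - 1) x y)
    (hG : ∀ (u : complexBetti A.X 1 ≃ₗ[ℂ] complexBetti A.X 1) (hu : u ∈ unitaryCentralizerGroup A h),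
      detOnEigenspace u (pullbackOne A φ) (fun x ↦ (mem_centralizerGroup_iff.1 hu.1) φ x)
        (Complex.I * (Real.sqrt d : ℂ)) = 1 → u ∈ hodgeGroupOne A.dim A.X)
    (hA'A : IsIsogenous A' A) : HodgeConjectureFor A'.dim A'.X :=
  HodgeConjectureFor.of_isIsogenous hA'A
    (hodgeConjectureFor_weilType_generalE_of_markman₆_nonsplit A φ d hMark₆ hRW6 hW φE hC hdiag hQ hK J' hJ' hJQ hφQ hG)

end Summit.HodgeConjecture.HodgeConjecture.TableX.WeilERows
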